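import Summits.MatrixMultiplication.MatrixMultiplication.Theorems.FarEdgeDescentTreeCap
import Summits.MatrixMultiplication.MatrixMultiplication.Theorems.FarEdgeDescentTreeCapEnvTools

/-!
# Far-edge descent, kernel XLI-F — the tree cap with LIGHT bases: the reachability envelope `w ≤ 3(2/3 − λ)` and the cap under an envelope (model level)

Kernel XLI-A's admissibility `Adm` restricts bases to the HEAVY window `(2β−1)μ ≤ 1` (`b ≥ 1/2` at
`β = 3/2`); the pair criterion genuinely fails on the box of light shares.  This file proves the tree
cap for ALL bases of the dial (`AdmL`: base window `βμ ≤ 1`, i.e. `b ≥ 0`), by adding the one piece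
of reachability that light shares require:
* `admL_invariants`: shares stay in `(0, 1/β]` (`1 − βλ_P = (1−βλ)(1−βλ') + β(β−1)λλ'`), wide
  share in `[0, λ]`, deviations `≥ 0`, sizes `≥ ℓ_min`; `wideL_le`, `potL_bounds`: `w ≤ (1−V_min)λ`,
  `0 ≤ Φ ≤ (1+ε−V_min)λ` on every admissible tree.
* `envelope_three_halves` (β = 3/2, V_min = 1/7): EVERY admissible tree has `w ≤ 2 − 3λ`.  Proof by
  induction: a base has `w = 0 ≤ 2 − 3μ`; at a node with `λ_P ≤ 14/27` the floor `w_P ≤ (6/7)λ_P`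
  already gives it; if `λ_P > 14/27` then a child has share `> 14/27 ≥ 12/25` (the product of two
  shares `≤ 14/27` has share `≤ 14/27`), and `q'·(2−3λ) + q·(6/7)λ' + λλ' ≤ 2 − 3λ_P` reduces to
  `λ'((25/14)λ − 6/7) ≥ 0`.  Hence `Φ ≤ capU(λ) = min((607/700)λ, 2 − (299/100)λ)` (`pot_le_capU`).
* `tree_cap_env`: the structural induction of XLI-A with factor caps `Φ ≤ U(λ)` for any envelope `U`
  valid on admissible trees, shares in the light window, and the pair criterion assumed on that polytope;
  `tree_cap_light_three_halves`: combined with the vertex reduction under an envelope (XLI-E), the cap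
  `y(T) ≤ 100R/ℓ_min^{κ_S}·Φ(T)·size(T)^{κ_S}` for every `AdmL (3/2) (1/7)` tree GIVEN the two vertex
  families (P1, Corner) for `capU` — discharged cell-wise in kernels XLI-G/H.
HONEST FRAMING: MODEL level (real-labelled product trees obeying the dial's exact product clauses);
nothing about tensors or `ω`; no `sorry`, no axioms.  Definitions: `AdmL`, `capU` (D-0009: plain
`def`s, no instances).  References: kernels XLI-A/B/E, memo NODE-g61 §3, Schönhage 1981 [Schonhage1981].
-/

noncomputable section

set_option linter.dupNamespace false

namespace Summit.MatrixMultiplication.MatrixMultiplication.Theorems.FarEdgeDescentTreeCapLight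

open Summit.MatrixMultiplication.MatrixMultiplication.Theorems.FarEdgeDescentChainCapSteps
open Summit.MatrixMultiplication.MatrixMultiplication.Theorems.FarEdgeDescentTreeCapTools
open Summit.MatrixMultiplication.MatrixMultiplication.Theorems.FarEdgeDescentTreeCapEnvTools
open Summit.MatrixMultiplication.MatrixMultiplication.Theorems.FarEdgeDescentTreeCap
open Summit.MatrixMultiplication.MatrixMultiplication.Theorems.FarEdgeDescentTreeCap.PTree

/-! ## Admissibility with light bases -/

namespace PTree

/-- Admissible trees over ALL bases of the dial: base share `0 < μ`, `βμ ≤ 1` (light window),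
deviation `0 ≤ yb ≤ R·μ`, size `ℓb ≥ ℓ_min`; every product node passes the depth-2 floor
`w ≤ (1 − V_min)·λ`. -/
def AdmL (β Vmin R ℓmin : ℝ) : PTree → Prop
  | leaf μ yb ℓb => 0 < μ ∧ β * μ ≤ 1 ∧ 0 ≤ yb ∧ yb ≤ R * μ ∧ ℓmin ≤ ℓb
  | node s t => AdmL β Vmin R ℓmin s ∧ AdmL β Vmin R ℓmin t ∧
      wide β (node s t) ≤ (1 - Vmin) * share β (node s t)

end PTree

open PTree

/-- The factor envelope at `β = 3/2`, `ε = 1/100`, `V_min = 1/7`: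
`capU(λ) = min((1+ε−V_min)λ, 2 − (3−ε)λ) = min((607/700)λ, 2 − (299/100)λ)` (kink at `λ = 14/27`). -/
def capU (l : ℝ) : ℝ := min (607 / 700 * l) (2 - 299 / 100 * l)

/-- Light-window invariants: `0 < λ`, `βλ ≤ 1`; `0 ≤ w ≤ λ`; `y ≥ 0`; `size ≥ ℓ_min`. -/
theorem admL_invariants {β Vmin R ℓmin : ℝ} (hβ : 1 ≤ β) (hR : 0 ≤ R) (hℓ : 0 < ℓmin) :
    ∀ T : PTree, AdmL β Vmin R ℓmin T →
      (0 < share β T ∧ β * share β T ≤ 1) ∧ (0 ≤ wide β T ∧ wide β T ≤ share β T) ∧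
      0 ≤ dev β T ∧ ℓmin ≤ size T
  | leaf μ yb ℓb, h => by
      obtain ⟨hμ0, hμ1, hy0, _, hℓb⟩ := h
      exact ⟨⟨hμ0, hμ1⟩, ⟨le_rfl, hμ0.le⟩, hy0, hℓb⟩
  | node s t, h => by
      obtain ⟨hs, ht, _⟩ := h
      obtain ⟨⟨hls0, hls1⟩, ⟨hws0, hws1⟩, hds, hℓs⟩ := admL_invariants hβ hR hℓ s hs
      obtain ⟨⟨hlt0, hlt1⟩, ⟨hwt0, hwt1⟩, hdt, hℓt⟩ := admL_invariants hβ hR hℓ t ht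
      have hqs : 0 ≤ 1 - β * share β s := by linarith
      have hqt : 0 ≤ 1 - β * share β t := by linarith
      have hns : 0 ≤ 1 - (β - 1) * share β s := by linarith
      have hnt : 0 ≤ 1 - (β - 1) * share β t := by linarith
      have hst : 0 < share β s * share β t := mul_pos hls0 hlt0
      have hqq : 0 ≤ (1 - β * share β s) * (1 - β * share β t) := mul_nonneg hqs hqt
      have eP : share β s + share β t - (2 * β - 1) * share β s * share β t =
          (1 - β * share β t) * share β s + (1 - β * share β s) * share β t
            + share β s * share β t := by ring
      refine ⟨⟨?_, ?_⟩, ⟨?_, ?_⟩, ?_, ?_⟩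
      · show 0 < share β s + share β t - (2 * β - 1) * share β s * share β t
        rw [eP]
        have := mul_nonneg hqt hls0.le
        have := mul_nonneg hqs hlt0.le
        linarith
      · show β * (share β s + share β t - (2 * β - 1) * share β s * share β t) ≤ 1
        have e : 1 - β * (share β s + share β t - (2 * β - 1) * share β s * share β t) =
            (1 - β * share β s) * (1 - β * share β t) + β * (β - 1) * (share β s * share β t) := by
          ring
        have : 0 ≤ β * (β - 1) * (share β s * share β t) :=
          mul_nonneg (mul_nonneg (by linarith) (by linarith)) hst.le
        linarith
      · show 0 ≤ (1 - β * share β t) * wide β s + (1 - β * share β s) * wide β t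
          + share β s * share β t
        have := mul_nonneg hqt hws0
        have := mul_nonneg hqs hwt0
        linarith
      · show (1 - β * share β t) * wide β s + (1 - β * share β s) * wide β t
          + share β s * share β t ≤ share β s + share β t - (2 * β - 1) * share β s * share β t
        rw [eP]
        have h1 := mul_le_mul_of_nonneg_left hws1 hqt
        have h2 := mul_le_mul_of_nonneg_left hwt1 hqs
        linarith
      · show 0 ≤ (1 - (β - 1) * share β t) * dev β s + (1 - (β - 1) * share β s) * dev β t
        have := mul_nonneg hnt hds
        have := mul_nonneg hns hdt
        linarith
      · show ℓmin ≤ size s + size t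
        linarith

/-- The wide share obeys the floor bound `w ≤ (1−V_min)λ` on every admissible tree (`V_min ≤ 1`). -/
theorem wideL_le {β Vmin R ℓmin : ℝ} (hV1 : Vmin ≤ 1)
    (T : PTree) (hT : AdmL β Vmin R ℓmin T) : wide β T ≤ (1 - Vmin) * share β T := by
  cases T with
  | leaf μ yb ℓb =>
      obtain ⟨hμ0, _, _, _, _⟩ := hT
      show (0:ℝ) ≤ (1 - Vmin) * μ
      exact mul_nonneg (by linarith) hμ0.le
  | node s t => exact hT.2.2

/-- `0 ≤ Φ ≤ (1+ε−V_min)λ` on every admissible tree (`0 ≤ ε`, `V_min ≤ 1`). -/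
theorem potL_bounds {β Vmin R ℓmin ε : ℝ} (hβ : 1 ≤ β) (hR : 0 ≤ R) (hℓ : 0 < ℓmin) (hε : 0 ≤ ε)
    (hV1 : Vmin ≤ 1) (T : PTree) (hT : AdmL β Vmin R ℓmin T) :
    0 ≤ pot β ε T ∧ pot β ε T ≤ (1 + ε - Vmin) * share β T := by
  obtain ⟨⟨hl0, _⟩, ⟨hw0, _⟩, _, _⟩ := admL_invariants hβ hR hℓ T hT
  have hw := wideL_le hV1 T hT
  refine ⟨by unfold pot; positivity, ?_⟩
  unfold pot
  linarith

/-! ## The reachability envelope at `β = 3/2` -/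

/-- One step of the envelope: real-variable form. -/
theorem envelope_step {ls lt ws wt : ℝ} (hls0 : 0 < ls) (hls1 : 3 / 2 * ls ≤ 1) (hlt0 : 0 < lt)
    (hlt1 : 3 / 2 * lt ≤ 1) (hwsF : ws ≤ (1 - 1 / 7) * ls) (hwsE : ws ≤ 2 - 3 * ls)
    (hwtF : wt ≤ (1 - 1 / 7) * lt) (hwtE : wt ≤ 2 - 3 * lt)
    (hfl : (1 - 3 / 2 * lt) * ws + (1 - 3 / 2 * ls) * wt + ls * lt ≤
      (1 - 1 / 7) * (ls + lt - (2 * (3 / 2 : ℝ) - 1) * ls * lt)) :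
    (1 - 3 / 2 * lt) * ws + (1 - 3 / 2 * ls) * wt + ls * lt ≤
      2 - 3 * (ls + lt - (2 * (3 / 2 : ℝ) - 1) * ls * lt) := by
  have hqs : 0 ≤ 1 - 3 / 2 * ls := by linarith
  have hqt : 0 ≤ 1 - 3 / 2 * lt := by linarith
  by_cases hP : ls + lt - (2 * (3 / 2 : ℝ) - 1) * ls * lt ≤ 14 / 27
  · linarith
  · push Not at hP
    -- some child has share > 14/27
    by_cases hs : 14 / 27 < ls
    · have h1 := mul_le_mul_of_nonneg_left hwsE hqt
      have h2 := mul_le_mul_of_nonneg_left hwtF hqs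
      have h3 : 0 ≤ lt * (25 / 14 * ls - 6 / 7) := mul_nonneg hlt0.le (by linarith)
      nlinarith
    · by_cases ht : 14 / 27 < lt
      · have h1 := mul_le_mul_of_nonneg_left hwsF hqt
        have h2 := mul_le_mul_of_nonneg_left hwtE hqs
        have h3 : 0 ≤ ls * (25 / 14 * lt - 6 / 7) := mul_nonneg hls0.le (by linarith)
        nlinarith
      · exfalso
        push Not at hs ht
        -- both shares ≤ 14/27 ⟹ λ_P ≤ 14/27
        rcases le_or_gt lt (1 / 2) with ht2 | ht2
        · have : 0 ≤ (14 / 27 - ls) * (1 - 2 * lt) := mul_nonneg (by linarith) (by linarith)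
          nlinarith
        · rcases le_or_gt ls (1 / 2) with hs2 | hs2
          · have : 0 ≤ (14 / 27 - lt) * (1 - 2 * ls) := mul_nonneg (by linarith) (by linarith)
            nlinarith
          · have : 0 < (ls - 1 / 2) * (lt - 1 / 2) := mul_pos (by linarith) (by linarith)
            nlinarith

/-- **The reachability envelope.**  Every `AdmL (3/2) (1/7)` tree has wide share `w ≤ 2 − 3λ`
(equality with the floor line `(6/7)λ` at the kink `λ = 14/27`). -/
theorem envelope_three_halves {R ℓmin : ℝ} (hR : 0 ≤ R) (hℓ : 0 < ℓmin) :
    ∀ T : PTree, AdmL (3 / 2) (1 / 7) R ℓmin T → wide (3 / 2) T ≤ 2 - 3 * share (3 / 2) T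
  | leaf μ yb ℓb, h => by
      obtain ⟨_, hμ1, _, _, _⟩ := h
      show (0:ℝ) ≤ 2 - 3 * μ
      linarith
  | node s t, h => by
      obtain ⟨hs, ht, hfl⟩ := h
      have h32 : (1:ℝ) ≤ 3 / 2 := by norm_num
      obtain ⟨⟨hls0, hls1⟩, _, _, _⟩ := admL_invariants h32 hR hℓ s hs
      obtain ⟨⟨hlt0, hlt1⟩, _, _, _⟩ := admL_invariants h32 hR hℓ t ht
      have hwsF := wideL_le (by norm_num : (1 / 7 : ℝ) ≤ 1) s hs
      have hwtF := wideL_le (by norm_num : (1 / 7 : ℝ) ≤ 1) t ht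
      have hwsE := envelope_three_halves hR hℓ s hs
      have hwtE := envelope_three_halves hR hℓ t ht
      exact envelope_step hls0 hls1 hlt0 hlt1 hwsF hwsE hwtF hwtE hfl

/-- `capU` is the left piece below the kink and the right piece above it. -/
theorem capU_eq_left {l : ℝ} (h : 27 / 7 * l ≤ 2) : capU l = 607 / 700 * l := by
  unfold capU; exact min_eq_left (by linarith)

/-- `capU` above the kink. -/
theorem capU_eq_right {l : ℝ} (h : 2 ≤ 27 / 7 * l) : capU l = 2 - 299 / 100 * l := by
  unfold capU; exact min_eq_right (by linarith)

/-- `capU(λ) ≤ (1+ε)λ` on the light window. -/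
theorem capU_le (l : ℝ) (hl0 : 0 < l) (_hl1 : 3 / 2 * l ≤ 1) : capU l ≤ (1 + 1 / 100) * l := by
  unfold capU
  have : 607 / 700 * l ≤ (1 + 1 / 100) * l := by nlinarith
  exact (min_le_left _ _).trans this

/-- The potential of every `AdmL (3/2) (1/7)` tree lies under the envelope `capU`. -/
theorem pot_le_capU {R ℓmin : ℝ} (hR : 0 ≤ R) (hℓ : 0 < ℓmin) (T : PTree)
    (hT : AdmL (3 / 2) (1 / 7) R ℓmin T) : pot (3 / 2) (1 / 100) T ≤ capU (share (3 / 2) T) := by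
  have h32 : (1:ℝ) ≤ 3 / 2 := by norm_num
  have h1 := (potL_bounds h32 hR hℓ (by norm_num : (0:ℝ) ≤ 1 / 100)
    (by norm_num : (1 / 7 : ℝ) ≤ 1) T hT).2
  have h2 := envelope_three_halves hR hℓ T hT
  unfold capU
  refine le_min (by linarith) ?_
  unfold pot
  linarith

/-! ## The cap under an envelope -/

/-- **Tree cap under an envelope.**  Let `1 ≤ β`, `0 < ε`, `0 ≤ V_min ≤ 1`, `0 ≤ R`, `0 < ℓ_min`, and
let `U` bound the potential of every admissible tree (`Φ(T) ≤ U(λ(T))`).  If the pair criterion holds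
for all light shares `λ, λ'` (`0 < λ`, `βλ ≤ 1`), all `0 ≤ Φ ≤ U(λ)`, `0 ≤ Φ' ≤ U(λ')` whose product
passes the floor, and all `x ∈ [0,1]`, then along every admissible tree
`y(T) ≤ R/(ε·ℓ_min^{κ_S})·Φ(T)·size(T)^{κ_S}`. -/
theorem tree_cap_env {β ε Vmin R ℓmin : ℝ} {U : ℝ → ℝ} (hβ : 1 ≤ β) (hε : 0 < ε) (hV1 : Vmin ≤ 1)
    (hR : 0 ≤ R) (hℓ : 0 < ℓmin)
    (hUpot : ∀ T : PTree, AdmL β Vmin R ℓmin T → pot β ε T ≤ U (share β T))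
    (hcrit : ∀ lA lB PA PB x : ℝ, 0 < lA → β * lA ≤ 1 → 0 < lB → β * lB ≤ 1 →
      0 ≤ PA → PA ≤ U lA → 0 ≤ PB → PB ≤ U lB →
      (1 - β * lB) * PA + (1 - β * lA) * PB + (1 + ε) * lA * lB ≤
        (1 + ε - Vmin) * (lA + lB - (2 * β - 1) * lA * lB) →
      0 ≤ x → x ≤ 1 →
      (1 - (β - 1) * lB) * PA * x ^ (Real.log (4 / 3) / Real.log 2) +
          (1 - (β - 1) * lA) * PB * (1 - x) ^ (Real.log (4 / 3) / Real.log 2) ≤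
        (1 - β * lB) * PA + (1 - β * lA) * PB + (1 + ε) * lA * lB) :
    ∀ T : PTree, AdmL β Vmin R ℓmin T →
      dev β T ≤ R / (ε * ℓmin ^ (Real.log (4 / 3) / Real.log 2)) * pot β ε T *
        size T ^ (Real.log (4 / 3) / Real.log 2)
  | leaf μ yb ℓb, h => by
      obtain ⟨hμ0, _, _, hyR, hℓb⟩ := h
      set κ := Real.log (4 / 3) / Real.log 2 with hκ
      have hκ0 : 0 ≤ κ := kappaS_nonneg
      have hℓb0 : 0 < ℓb := lt_of_lt_of_le hℓ hℓb
      have hpow : ℓmin ^ κ ≤ ℓb ^ κ := Real.rpow_le_rpow hℓ.le hℓb hκ0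
      have hmin : 0 < ℓmin ^ κ := Real.rpow_pos_of_pos hℓ κ
      show yb ≤ R / (ε * ℓmin ^ κ) * (0 + ε * μ) * ℓb ^ κ
      have h1 : R / (ε * ℓmin ^ κ) * (0 + ε * μ) * ℓb ^ κ = R * μ * (ℓb ^ κ / ℓmin ^ κ) := by
        field_simp
        ring
      rw [h1]
      have h2 : 1 ≤ ℓb ^ κ / ℓmin ^ κ := by rw [le_div_iff₀ hmin]; linarith
      have h3 : 0 ≤ R * μ := mul_nonneg hR hμ0.le
      nlinarith
  | node s t, h => by
      obtain ⟨hs, ht, hfl⟩ := h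
      set κ := Real.log (4 / 3) / Real.log 2 with hκ
      have hκ0 : 0 ≤ κ := kappaS_nonneg
      have ihs := tree_cap_env hβ hε hV1 hR hℓ hUpot hcrit s hs
      have iht := tree_cap_env hβ hε hV1 hR hℓ hUpot hcrit t ht
      obtain ⟨⟨hls0, hls1⟩, _, _, hℓs⟩ := admL_invariants hβ hR hℓ s hs
      obtain ⟨⟨hlt0, hlt1⟩, _, _, hℓt⟩ := admL_invariants hβ hR hℓ t ht
      have hPs0 := (potL_bounds hβ hR hℓ hε.le hV1 s hs).1
      have hPt0 := (potL_bounds hβ hR hℓ hε.le hV1 t ht).1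
      have hPs1 := hUpot s hs
      have hPt1 := hUpot t ht
      have hsz_s : 0 < size s := lt_of_lt_of_le hℓ hℓs
      have hsz_t : 0 < size t := lt_of_lt_of_le hℓ hℓt
      have hsz : 0 < size s + size t := by linarith
      set W := R / (ε * ℓmin ^ κ) with hW
      have hW0 : 0 ≤ W := div_nonneg hR (mul_nonneg hε.le (Real.rpow_nonneg hℓ.le κ))
      have hns : 0 ≤ 1 - (β - 1) * share β s := by linarith
      have hnt : 0 ≤ 1 - (β - 1) * share β t := by linarith
      -- the floor at the node, in potential form
      have hflP : (1 - β * share β t) * pot β ε s + (1 - β * share β s) * pot β ε t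
          + (1 + ε) * share β s * share β t ≤
          (1 + ε - Vmin) * (share β s + share β t - (2 * β - 1) * share β s * share β t) := by
        have := (potL_bounds hβ hR hℓ hε.le hV1 (node s t) ⟨hs, ht, hfl⟩).2
        rw [pot_node] at this
        exact this
      -- the size ratio
      set x := size s / (size s + size t) with hx
      have hx0 : 0 ≤ x := div_nonneg hsz_s.le hsz.le
      have hx1 : x ≤ 1 := by rw [hx, div_le_one hsz]; linarith
      have hxs : size s = x * (size s + size t) := by rw [hx]; field_simp
      have hxt : size t = (1 - x) * (size s + size t) := by rw [hx]; field_simp; ring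
      have hpow_s : size s ^ κ = x ^ κ * (size s + size t) ^ κ := by
        rw [hxs, Real.mul_rpow hx0 hsz.le, ← hxs]
      have hpow_t : size t ^ κ = (1 - x) ^ κ * (size s + size t) ^ κ := by
        rw [hxt, Real.mul_rpow (by linarith) hsz.le, ← hxt]
      have hC := hcrit (share β s) (share β t) (pot β ε s) (pot β ε t) x hls0 hls1 hlt0 hlt1
        hPs0 hPs1 hPt0 hPt1 hflP hx0 hx1
      have hS0 : 0 ≤ (size s + size t) ^ κ := Real.rpow_nonneg hsz.le κ
      show (1 - (β - 1) * share β t) * dev β s + (1 - (β - 1) * share β s) * dev β t ≤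
        W * pot β ε (node s t) * (size s + size t) ^ κ
      rw [pot_node]
      have h1 : (1 - (β - 1) * share β t) * dev β s ≤
          (1 - (β - 1) * share β t) * (W * pot β ε s * size s ^ κ) :=
        mul_le_mul_of_nonneg_left ihs hnt
      have h2 : (1 - (β - 1) * share β s) * dev β t ≤
          (1 - (β - 1) * share β s) * (W * pot β ε t * size t ^ κ) :=
        mul_le_mul_of_nonneg_left iht hns
      have h3 := mul_le_mul_of_nonneg_left (mul_le_mul_of_nonneg_right hC hS0) hW0
      rw [hpow_s] at h1
      rw [hpow_t] at h2
      nlinarith [h1, h2, h3]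

/-- **Light-base tree cap at `β = 3/2`, given the two vertex families for `capU`.**  If the P1 family
and the Corner family of the vertex reduction (kernel XLI-E) hold for the envelope `capU` and the
product cap `(607/700)λ_P`, then along EVERY `AdmL (3/2) (1/7)` tree (all bases `b ≥ 0`)
`y(T) ≤ 100R/ℓ_min^{κ_S} · Φ(T) · size(T)^{κ_S}`. -/
theorem tree_cap_light_three_halves {R ℓmin : ℝ} (hR : 0 ≤ R) (hℓ : 0 < ℓmin)
    (hP1 : ∀ lA lB x : ℝ, 0 < lA → (3 / 2 : ℝ) * lA ≤ 1 → 0 < lB → (3 / 2 : ℝ) * lB ≤ 1 →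
      0 ≤ x → x ≤ 1 →
      0 ≤ (1 + 1 / 100 - 1 / 7) * (lA + lB - (2 * (3 / 2 : ℝ) - 1) * lA * lB)
        - (1 + 1 / 100) * lA * lB →
      (1 + 1 / 100 - 1 / 7) * (lA + lB - (2 * (3 / 2 : ℝ) - 1) * lA * lB) - (1 + 1 / 100) * lA * lB <
        (1 - 3 / 2 * lB) * capU lA + (1 - 3 / 2 * lA) * capU lB →
      (1 - 3 / 2 * lA) * (1 - (3 / 2 - 1) * lB) * capU lA * x ^ (Real.log (4 / 3) / Real.log 2) +
          (1 - (3 / 2 - 1) * lA) * ((1 + 1 / 100 - 1 / 7) * (lA + lB - (2 * (3 / 2 : ℝ) - 1) * lA * lB)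
            - (1 + 1 / 100) * lA * lB - (1 - 3 / 2 * lB) * capU lA) *
            (1 - x) ^ (Real.log (4 / 3) / Real.log 2) ≤
        (1 - 3 / 2 * lA) * ((1 + 1 / 100 - 1 / 7) * (lA + lB - (2 * (3 / 2 : ℝ) - 1) * lA * lB)))
    (hC : ∀ lA lB x : ℝ, 0 < lA → (3 / 2 : ℝ) * lA ≤ 1 → 0 < lB → (3 / 2 : ℝ) * lB ≤ 1 →
      0 ≤ x → x ≤ 1 →
      (1 - 3 / 2 * lB) * capU lA + (1 - 3 / 2 * lA) * capU lB ≤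
        (1 + 1 / 100 - 1 / 7) * (lA + lB - (2 * (3 / 2 : ℝ) - 1) * lA * lB) - (1 + 1 / 100) * lA * lB →
      (1 - (3 / 2 - 1) * lB) * capU lA * x ^ (Real.log (4 / 3) / Real.log 2) +
          (1 - (3 / 2 - 1) * lA) * capU lB * (1 - x) ^ (Real.log (4 / 3) / Real.log 2) ≤
        (1 - 3 / 2 * lB) * capU lA + (1 - 3 / 2 * lA) * capU lB + (1 + 1 / 100) * lA * lB) :
    ∀ T : PTree, AdmL (3 / 2) (1 / 7) R ℓmin T →
      dev (3 / 2) T ≤ R / (1 / 100 * ℓmin ^ (Real.log (4 / 3) / Real.log 2)) *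
        pot (3 / 2) (1 / 100) T * size T ^ (Real.log (4 / 3) / Real.log 2) :=
  tree_cap_env (U := capU) (by norm_num) (by norm_num) (by norm_num) hR hℓ (pot_le_capU hR hℓ)
    (criterion_of_vertex_env (β := 3 / 2) (ε := 1 / 100) (U := capU)
      (W := fun l : ℝ => (1 + 1 / 100 - 1 / 7) * l) (by norm_num) capU_le hP1 hC)

/-- **Corollary: one constant.**  Under the hypotheses of `tree_cap_light_three_halves`, every
`AdmL (3/2) (1/7)` tree has `y(T) ≤ 58·R/ℓ_min^{κ_S} · size(T)^{κ_S}`. -/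
theorem tree_cap_light_three_halves_uniform {R ℓmin : ℝ} (hR : 0 ≤ R) (hℓ : 0 < ℓmin)
    (hP1 : ∀ lA lB x : ℝ, 0 < lA → (3 / 2 : ℝ) * lA ≤ 1 → 0 < lB → (3 / 2 : ℝ) * lB ≤ 1 →
      0 ≤ x → x ≤ 1 →
      0 ≤ (1 + 1 / 100 - 1 / 7) * (lA + lB - (2 * (3 / 2 : ℝ) - 1) * lA * lB)
        - (1 + 1 / 100) * lA * lB →
      (1 + 1 / 100 - 1 / 7) * (lA + lB - (2 * (3 / 2 : ℝ) - 1) * lA * lB) - (1 + 1 / 100) * lA * lB <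
        (1 - 3 / 2 * lB) * capU lA + (1 - 3 / 2 * lA) * capU lB →
      (1 - 3 / 2 * lA) * (1 - (3 / 2 - 1) * lB) * capU lA * x ^ (Real.log (4 / 3) / Real.log 2) +
          (1 - (3 / 2 - 1) * lA) * ((1 + 1 / 100 - 1 / 7) * (lA + lB - (2 * (3 / 2 : ℝ) - 1) * lA * lB)
            - (1 + 1 / 100) * lA * lB - (1 - 3 / 2 * lB) * capU lA) *
            (1 - x) ^ (Real.log (4 / 3) / Real.log 2) ≤
        (1 - 3 / 2 * lA) * ((1 + 1 / 100 - 1 / 7) * (lA + lB - (2 * (3 / 2 : ℝ) - 1) * lA * lB)))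
    (hC : ∀ lA lB x : ℝ, 0 < lA → (3 / 2 : ℝ) * lA ≤ 1 → 0 < lB → (3 / 2 : ℝ) * lB ≤ 1 →
      0 ≤ x → x ≤ 1 →
      (1 - 3 / 2 * lB) * capU lA + (1 - 3 / 2 * lA) * capU lB ≤
        (1 + 1 / 100 - 1 / 7) * (lA + lB - (2 * (3 / 2 : ℝ) - 1) * lA * lB) - (1 + 1 / 100) * lA * lB →
      (1 - (3 / 2 - 1) * lB) * capU lA * x ^ (Real.log (4 / 3) / Real.log 2) +
          (1 - (3 / 2 - 1) * lA) * capU lB * (1 - x) ^ (Real.log (4 / 3) / Real.log 2) ≤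
        (1 - 3 / 2 * lB) * capU lA + (1 - 3 / 2 * lA) * capU lB + (1 + 1 / 100) * lA * lB)
    (T : PTree) (hT : AdmL (3 / 2) (1 / 7) R ℓmin T) :
    dev (3 / 2) T ≤ 58 * R / ℓmin ^ (Real.log (4 / 3) / Real.log 2) *
      size T ^ (Real.log (4 / 3) / Real.log 2) := by
  set κ := Real.log (4 / 3) / Real.log 2 with hκ
  have h := tree_cap_light_three_halves hR hℓ hP1 hC T hT
  have h32 : (1:ℝ) ≤ 3 / 2 := by norm_num
  obtain ⟨⟨hl0, hl1⟩, _, _, hℓT⟩ := admL_invariants h32 hR hℓ T hT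
  obtain ⟨hP0, hPM⟩ := potL_bounds h32 hR hℓ (by norm_num : (0:ℝ) ≤ 1 / 100)
    (by norm_num : (1 / 7 : ℝ) ≤ 1) T hT
  have hsz : 0 < size T := lt_of_lt_of_le hℓ hℓT
  have hS0 : 0 ≤ size T ^ κ := Real.rpow_nonneg hsz.le κ
  have hmin : 0 < ℓmin ^ κ := Real.rpow_pos_of_pos hℓ κ
  have hPle : pot (3 / 2) (1 / 100) T ≤ 58 / 100 := by nlinarith
  have hU0 : 0 ≤ R / (1 / 100 * ℓmin ^ κ) := div_nonneg hR (by positivity)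
  calc dev (3 / 2) T ≤ R / (1 / 100 * ℓmin ^ κ) * pot (3 / 2) (1 / 100) T * size T ^ κ := h
    _ ≤ R / (1 / 100 * ℓmin ^ κ) * (58 / 100) * size T ^ κ := by
        apply mul_le_mul_of_nonneg_right _ hS0
        exact mul_le_mul_of_nonneg_left hPle hU0
    _ = 58 * R / ℓmin ^ κ * size T ^ κ := by
        congr 1
        field_simp

end Summit.MatrixMultiplication.MatrixMultiplication.Theorems.FarEdgeDescentTreeCapLight
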